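import Literature.Probability.RandomPlanarGeometry.DrivingFunctionMeasurable
import Literature.Probability.Process.AlmostContinuousMapping
import HarnessLib

/-!
# Loewner regularity and driving-process convergence of weak limits from uniformly likely events

Topic `Literature/Probability/RandomPlanarGeometry` (family `crit-ising`); theorems only (no
definition, no named fact). Glue between the deterministic Loewner theory of random curves
(`LoewnerDescription.lean`, `DrivingFunctionMeasurable.lean`, `LoewnerCurveLimit.lean`) and the
probabilistic conclusion of

* A. Kemppainen, S. Smirnov, *Random curves, scaling limits and Loewner evolutions*, Ann. Probab.
  45 (2017) 698–779, **Thm. 1.5 (ii)–(iii)** with Cor. 1.7 (arXiv:1212.6215: Thm. 1.3, Cor. 1.5):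
  under Condition G2, if `γ_n → γ` weakly then a.s. the limit curve (conformally transported to
  `ℍ`) is described by the Loewner equation with a continuous driving term `W = W(γ)`, and the
  driving processes `W_n = W(γ_n)` converge in law to `W(γ)`, jointly with the curves.

Kemppainen–Smirnov reduce this (§3.1, Prop. 3.2) to the tightness of four random variables and
conclude (§3.5, p. 18 of the arXiv text): "Fix `ε > 0`. We will first choose four events `E_k`
… `P(E_k) ≥ 1 - ε/4` for all `P ∈ Σ_𝔻` … denote `E = ⋂ E_k` … Now the rest of the claims
follow from Lemma A.5 [the deterministic main lemma: on `E`, limits of curves are Loewner curves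
driven by the limits of the driving terms]". This file PROVES that last step in the tree's
vocabulary, for a FIXED chordal uniformizing map `φ : ℍ → D` of the Dobrushin domain (the
describability predicate `IsLoewnerDescribable φ` and the Loewner transform `drivingFunction φ`
of `LoewnerDescription.lean`, Borel by `measurable_drivingPathOf`): given, for every `ε > 0`, a
closed set `K_ε` of curve classes, all describable through `φ`, on which the driving path
`c ↦ W(c) ∈ C([0, ∞), ℝ)` is continuous (the output of the deterministic main lemma on
`E(ε)`), and which carries mass `≥ 1 - ε` under every approximating law (the output of
Prop. 3.2), every weak limit `ν` is a.e. describable and `(γ_n, W(γ_n)) → (γ, W(γ))` in law: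

* `tendstoInDistribution_id_of_forall_integral_tendsto` — bookkeeping: weak convergence of laws
  on the curve space, in the integral form used by `LatticeModels/InterfaceSLE*.lean`, as
  `TendstoInDistribution` of the identity;
* `ae_isLoewnerDescribable_of_forall_exists_isClosed` — **Thm. 1.5 (ii) from the events**;
* `tendstoInDistribution_prodMk_drivingPath_of_forall_exists_isClosed` — **Thm. 1.5 (iii) /
  Cor. 1.7 from the events**, joint convergence in law of `(c, W(c))` on
  `CurveClass ℂ × C([0, ∞), ℝ)`; `tendstoInDistribution_drivingPath_of_forall_exists_isClosed` —
  the driving processes alone;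
* `ae_isLoewnerDescribable_and_tendstoInDistribution_drivingPath` — both, for a sequence of laws
  and events likely for ALL `n` (KS's "for all `P ∈ Σ`"), in the exact shape of the
  Kemppainen–Smirnov clauses (J′) consumed by
  `LatticeModels.isSLELaw_three_of_subseqLimit_spinInterface_of_limitData`
  (`InterfaceSLELimitData.lean`, with `Ω' k = CurveClass ℂ`, `P k = μs k`,
  `V k u c = drivingFunction φ c u`) and by the FK analogue
  (`FKIsingCylinderIdentityAssembly.lean`).

The measure theory is `Process/AlmostContinuousMapping.lean` (support transfer and the
almost-continuous mapping theorem, by the closed-set portmanteau theorem; no Skorokhod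
representation). What is NOT here: the construction of the events (KS Prop. 3.2: Condition G2 ⇒
tightness of the transience index, of the Hölder norms of curve and driver, and of the
tip-geodesic modulus — §§3.2–3.4) and the deterministic main lemma on them (KS App. A,
Lemmas A.4–A.5; the tree has Lemma A.4 as `exists_capacity_parametrisation_of_limit`,
`LoewnerCurveLimit.lean`).

## References

* A. Kemppainen, S. Smirnov, Ann. Probab. 45 (2017) 698–779: Thm. 1.5, Cor. 1.7, §3.1
  (Prop. 3.2), §3.5 (proof of the main theorem), App. A (arXiv:1212.6215: Thm. 1.3, Cor. 1.5,
  Prop. 3.2, §3.5 p. 18, Lemmas 5.5–5.7). [KemppainenSmirnov2017]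
* D. Chelkak, H. Duminil-Copin, C. Hongler, A. Kemppainen, S. Smirnov, C. R. Math. Acad. Sci.
  Paris 352 (2014) 157–161, Thm. 3 (= KS Thm. 1.5 for the FK-Ising and spin-Ising interfaces).
  [CDHKSCRAS2014]
-/

noncomputable section

open MeasureTheory Filter Topology Set
open UpperHalfPlane (upperHalfPlaneSet)
open scoped NNReal ENNReal BoundedContinuousFunction

namespace Literature.Probability.RandomPlanarGeometry

open scoped PathBorel

/-! ### Weak convergence of curve laws as convergence in distribution of the identity -/

section Generic

variable {E : Type*} [MeasurableSpace E] [TopologicalSpace E] [OpensMeasurableSpace E]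
  {ι : Type*} {L : Filter ι} {μs : ι → Measure E} [∀ i, IsProbabilityMeasure (μs i)]
  {ν : Measure E} [IsProbabilityMeasure ν]

/-- Weak convergence of probability laws `μs i → ν`, stated through integrals of bounded
continuous functions (the form of `LatticeModels.isSLELaw_three_of_subseqLimit_spinInterface`),
is convergence in distribution of the identity random variable of `(E, μs i)` to that of
`(E, ν)`. [folklore] -/
theorem tendstoInDistribution_id_of_forall_integral_tendsto
    (hlim : ∀ f : E →ᵇ ℝ, Tendsto (fun i ↦ ∫ x, f x ∂μs i) L (𝓝 (∫ x, f x ∂ν))) :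
    TendstoInDistribution (fun (_ : ι) (x : E) ↦ x) L (fun x ↦ x) μs ν where
  forall_aemeasurable _ := aemeasurable_id'
  aemeasurable_limit := aemeasurable_id'
  tendsto := by
    refine ProbabilityMeasure.tendsto_iff_forall_integral_tendsto.2 fun f ↦ ?_
    simp only [ProbabilityMeasure.coe_mk, Measure.map_id']
    exact hlim f

/-- Conversely, convergence in distribution of the identity is weak convergence of the laws in
integral form. [folklore] -/
theorem forall_integral_tendsto_of_tendstoInDistribution_id
    (h : TendstoInDistribution (fun (_ : ι) (x : E) ↦ x) L (fun x ↦ x) μs ν) (f : E →ᵇ ℝ) :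
    Tendsto (fun i ↦ ∫ x, f x ∂μs i) L (𝓝 (∫ x, f x ∂ν)) := by
  have key := (ProbabilityMeasure.tendsto_iff_forall_integral_tendsto.1 h.tendsto) f
  simp only [ProbabilityMeasure.coe_mk, Measure.map_id'] at key
  exact key

end Generic

/-! ### Kemppainen–Smirnov's Theorem 1.5 (ii)–(iii) from the uniformly likely events -/

variable {D : DobrushinDomain} {φ : ConformalEquiv upperHalfPlaneSet D.carrier}
  {ι : Type*} {L : Filter ι} {μs : ι → Measure (CurveClass ℂ)} [∀ i, IsProbabilityMeasure (μs i)]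
  {ν : Measure (CurveClass ℂ)} [IsProbabilityMeasure ν]

/-- **Kemppainen–Smirnov Thm. 1.5 (ii) from the uniformly likely events.** Let the curve laws
`μs i` converge weakly to `ν`. If for every `ε > 0` there is a CLOSED set `F` of curve classes,
each describable by the Loewner evolution through `φ` (`IsLoewnerDescribable φ`), with
`μs i Fᶜ ≤ ε` frequently (KS: `F ⊇` the event `E = ⋂ E_k` of §3.5, closed and made of Loewner
curves by the main lemma, `P(E) ≥ 1 - ε` for all `P ∈ Σ_𝔻`), then `ν`-a.e. curve class is
describable through `φ`. PROVED (support transfer, `Process.ae_mem_of_forall_exists_isClosed_subset`).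
[cite: KemppainenSmirnov2017, Thm. 1.5 (ii) and §3.5] -/
theorem ae_isLoewnerDescribable_of_forall_exists_isClosed
    (hlim : ∀ f : CurveClass ℂ →ᵇ ℝ, Tendsto (fun i ↦ ∫ c, f c ∂μs i) L (𝓝 (∫ c, f c ∂ν)))
    (h : ∀ ε : ℝ≥0∞, 0 < ε → ∃ F : Set (CurveClass ℂ), IsClosed F ∧
      (∀ c ∈ F, IsLoewnerDescribable φ c) ∧ ∃ᶠ i in L, μs i Fᶜ ≤ ε) :
    ∀ᵐ c ∂ν, IsLoewnerDescribable φ c :=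
  Process.ae_mem_of_tendstoInDistribution_of_forall_exists_isClosed_subset
    (G := {c | IsLoewnerDescribable φ c}) (tendstoInDistribution_id_of_forall_integral_tendsto hlim)
    fun ε hε ↦ by
      obtain ⟨F, hF, hFG, hfr⟩ := h ε hε
      exact ⟨F, hF, hFG, hfr⟩

/-- **Kemppainen–Smirnov Thm. 1.5 (iii) with Cor. 1.7 from the uniformly likely events: joint
convergence in law of the curve and its driving process.** Let `φ` be a chordal uniformizing map
of `(D; a, b)` and let the curve laws `μs i` converge weakly to `ν` along a countably generated
filter. If for every `ε > 0` there is a closed set `K` of curve classes on which the driving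
path `c ↦ W(c) = drivingFunction φ c ∈ C([0, ∞), ℝ)` (locally uniform topology) is continuous,
with `μs i Kᶜ ≤ ε` eventually (KS: on `E = ⋂ E_k` the driving terms are equicontinuous and every
limit of curves in `E` is driven by the limit of their driving terms, Lemmas A.4–A.5, which is
the continuity of `W` on the closure of `E`), then the pairs `(c, W(c))` converge in law:
`(μs i)_* (id, W) → ν_* (id, W)` on `CurveClass ℂ × C([0, ∞), ℝ)` ("the sequence of pairs
`(γ_n, W_n)` … the limits agree in the sense that the limiting curve is driven by the limiting
driving process", proof of Cor. 1.7). PROVED (almost-continuous mapping theorem,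
`Process.tendstoInDistribution_prodMk_comp_of_forall_exists_isClosed_continuousOn`).
[cite: KemppainenSmirnov2017, Thm. 1.5 (iii), Cor. 1.7 and §3.5] -/
theorem tendstoInDistribution_prodMk_drivingPath_of_forall_exists_isClosed
    [L.IsCountablyGenerated] (hφ : D.IsChordalUniformizing φ)
    (hlim : ∀ f : CurveClass ℂ →ᵇ ℝ, Tendsto (fun i ↦ ∫ c, f c ∂μs i) L (𝓝 (∫ c, f c ∂ν)))
    (h : ∀ ε : ℝ≥0∞, 0 < ε → ∃ K : Set (CurveClass ℂ), IsClosed K ∧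
      ContinuousOn (fun c ↦ (⟨drivingFunction φ c, continuous_drivingFunction φ c⟩ : C(ℝ≥0, ℝ))) K ∧
      ∀ᶠ i in L, μs i Kᶜ ≤ ε) :
    TendstoInDistribution
      (fun (_ : ι) (c : CurveClass ℂ) ↦
        (c, (⟨drivingFunction φ c, continuous_drivingFunction φ c⟩ : C(ℝ≥0, ℝ))))
      L (fun c ↦ (c, (⟨drivingFunction φ c, continuous_drivingFunction φ c⟩ : C(ℝ≥0, ℝ)))) μs ν :=
  Process.tendstoInDistribution_prodMk_comp_of_forall_exists_isClosed_continuousOn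
    (tendstoInDistribution_id_of_forall_integral_tendsto hlim) (measurable_drivingPathOf hφ) h

/-- **Kemppainen–Smirnov Thm. 1.5 (iii) from the uniformly likely events: the driving processes
converge in law** (the `C([0, ∞), ℝ)`-marginal of
`tendstoInDistribution_prodMk_drivingPath_of_forall_exists_isClosed`): `W_n = W(γ_n) → W(γ)` in
distribution for the topology of locally uniform convergence. PROVED.
[cite: KemppainenSmirnov2017, Thm. 1.5 (iii) and §3.5] -/
theorem tendstoInDistribution_drivingPath_of_forall_exists_isClosed
    [L.IsCountablyGenerated] (hφ : D.IsChordalUniformizing φ)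
    (hlim : ∀ f : CurveClass ℂ →ᵇ ℝ, Tendsto (fun i ↦ ∫ c, f c ∂μs i) L (𝓝 (∫ c, f c ∂ν)))
    (h : ∀ ε : ℝ≥0∞, 0 < ε → ∃ K : Set (CurveClass ℂ), IsClosed K ∧
      ContinuousOn (fun c ↦ (⟨drivingFunction φ c, continuous_drivingFunction φ c⟩ : C(ℝ≥0, ℝ))) K ∧
      ∀ᶠ i in L, μs i Kᶜ ≤ ε) :
    TendstoInDistribution
      (fun (_ : ι) (c : CurveClass ℂ) ↦
        (⟨drivingFunction φ c, continuous_drivingFunction φ c⟩ : C(ℝ≥0, ℝ)))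
      L (fun c ↦ (⟨drivingFunction φ c, continuous_drivingFunction φ c⟩ : C(ℝ≥0, ℝ))) μs ν :=
  Process.tendstoInDistribution_comp_of_forall_exists_isClosed_continuousOn
    (tendstoInDistribution_id_of_forall_integral_tendsto hlim) (measurable_drivingPathOf hφ) h

/-- **Kemppainen–Smirnov Thm. 1.5 (ii)–(iii) from the events, in the shape of the limit data
(J′).** For a sequence of curve laws `μs n → ν` weakly and a chordal uniformizing map `φ`: if for
every `ε > 0` there is a closed set `K` of curve classes, all describable through `φ`, on which
the driving path is continuous, and with `μs n Kᶜ ≤ ε` for ALL `n` (KS §3.5: "`P(E) ≥ 1 - ε` for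
all `P ∈ Σ_𝔻`"), then `ν`-a.e. curve class is describable through `φ` and the driving processes
`V n u c = drivingFunction φ c u` on `(CurveClass ℂ, μs n)` converge in distribution to the
driving function under `ν` — the clauses `hdesc`, `hlaw` of
`LatticeModels.isSLELaw_three_of_subseqLimit_spinInterface_of_limitData` /
`FKIsingCylinderIdentityAssembly`. PROVED. [cite: KemppainenSmirnov2017, Thm. 1.5, Cor. 1.7, §3.5] -/
theorem ae_isLoewnerDescribable_and_tendstoInDistribution_drivingPath
    (hφ : D.IsChordalUniformizing φ) {μs : ℕ → Measure (CurveClass ℂ)}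
    [∀ n, IsProbabilityMeasure (μs n)]
    (hlim : ∀ f : CurveClass ℂ →ᵇ ℝ, Tendsto (fun n ↦ ∫ c, f c ∂μs n) atTop (𝓝 (∫ c, f c ∂ν)))
    (h : ∀ ε : ℝ≥0∞, 0 < ε → ∃ K : Set (CurveClass ℂ), IsClosed K ∧
      (∀ c ∈ K, IsLoewnerDescribable φ c) ∧
      ContinuousOn (fun c ↦ (⟨drivingFunction φ c, continuous_drivingFunction φ c⟩ : C(ℝ≥0, ℝ))) K ∧
      ∀ n, μs n Kᶜ ≤ ε) :
    (∀ᵐ c ∂ν, IsLoewnerDescribable φ c) ∧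
      TendstoInDistribution
        (fun (_ : ℕ) (c : CurveClass ℂ) ↦
          (⟨fun u ↦ drivingFunction φ c u, continuous_drivingFunction φ c⟩ : C(ℝ≥0, ℝ)))
        atTop (fun c ↦ (⟨drivingFunction φ c, continuous_drivingFunction φ c⟩ : C(ℝ≥0, ℝ))) μs ν := by
  refine ⟨ae_isLoewnerDescribable_of_forall_exists_isClosed hlim fun ε hε ↦ ?_,
    tendstoInDistribution_drivingPath_of_forall_exists_isClosed hφ hlim fun ε hε ↦ ?_⟩
  · obtain ⟨K, hK, hdesc, -, hall⟩ := h ε hε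
    exact ⟨K, hK, hdesc, Frequently.of_forall hall⟩
  · obtain ⟨K, hK, -, hcont, hall⟩ := h ε hε
    exact ⟨K, hK, hcont, Eventually.of_forall hall⟩

end Literature.Probability.RandomPlanarGeometry
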